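import Literature.Probability.RandomPlanarGeometry.ChordalCurveFamily
import Literature.Probability.RandomPlanarGeometry.LoewnerCurveLimitDomain
import HarnessLib

/-!
# The remaining domain of an explored chordal curve is the conformal image of `ℍ ∖ K_r`

Topic `Literature/Probability/RandomPlanarGeometry`; theorems only (no definition, no named
fact). Let `(D; a, b)` be a Dobrushin domain with chordal uniformizing map `φ : ℍ → D`
(boundary values `a` at `0`, `b` at `∞`) and boundary extension `Φ = φ.boundaryExtension`, and
let the Loewner chain of `W` be generated by the half-plane curve `γ` (`Loewner.IsGeneratedByCurve`,
so that `K_r = ℍ ∖ V_∞` with `V_∞` the unbounded connected component of `ℍ ∖ γ[0, r]`). If the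
explored initial piece `past` of a curve in `D` has trace `Φ (γ[0, r])`, then the typed
**remaining domain** `remainingDomain D past` of `ChordalCurveFamily.lean` — the union of the
connected components of `D ∖ past` whose closure contains the target `b = D.pt 1` (Werner
(2007), §3.2 (2): "`D_t` is the connected component of `D ∖ γ[0, t]` that contains a
neighborhood of `c`") — is exactly `Φ (ℍ ∖ K_r) = φ (V_∞)`
(`remainingDomain_eq_image_of_range_eq`).

Proof (plane topology + Carathéodory): `φ` is a homeomorphism of `ℍ` onto `D` and `Φ` sends real
points to `∂D`, so `D ∖ Φ (γ[0, r]) = φ (ℍ ∖ γ[0, r])`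
(`MarkedDomain.carrier_diff_image_boundaryExtension`) and connected components correspond
(`ConformalEquiv.image_connectedComponentIn`); the image of the unbounded component
accumulates at `b` because `Φ z → b` as `z → ∞` in `ℍ̄`
(`MarkedDomain.IsChordalUniformizing.pt_one_mem_closure_image_unboundedComponent`), while the
image of a bounded component stays away from `b` because `Φ` is continuous on `ℍ̄` and takes the
value `b` at no finite point (`MarkedDomain.IsChordalUniformizing.pt_one_notMem_closure_image`).

## References

* W. Werner, *Lectures on two-dimensional critical percolation*, IAS/Park City (2007),
  arXiv:0710.0856, §3.2. [Werner2007]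
* Ch. Pommerenke, *Boundary Behaviour of Conformal Maps*, Springer (1992), Thm. 2.6.
  [PommerenkeBBCM1992]
-/

noncomputable section

open Set Filter Topology Complex Metric Bornology
open UpperHalfPlane (upperHalfPlaneSet isOpen_upperHalfPlaneSet)
open scoped NNReal

namespace Literature.Probability.RandomPlanarGeometry

/-! ### Connected components under a conformal equivalence -/

namespace ConformalEquiv

variable {U₀ V₀ : Set ℂ} (φ : ConformalEquiv U₀ V₀)

/-- **Connected components correspond under a conformal equivalence**: for `U ⊆ U₀` and `z ∈ U`,
the connected component of `φ z` in `φ (U)` is the image of the connected component of `z` in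
`U` (`φ|U₀` is a homeomorphism onto `V₀`; cf. Mathlib's `Homeomorph.image_connectedComponentIn`).
[folklore] -/
theorem image_connectedComponentIn {U : Set ℂ} (hU : U ⊆ U₀) {z : ℂ} (hz : z ∈ U) :
    φ '' connectedComponentIn U z = connectedComponentIn (φ '' U) (φ z) := by
  refine Subset.antisymm ?_ ?_
  · exact (isPreconnected_connectedComponentIn.image _
      (φ.continuousOn.mono ((connectedComponentIn_subset U z).trans hU))
      ).subset_connectedComponentIn (mem_image_of_mem _ (mem_connectedComponentIn hz))
      (image_mono (connectedComponentIn_subset U z))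
  · set C := connectedComponentIn (φ '' U) (φ z)
    have hCsub : C ⊆ φ '' U := connectedComponentIn_subset _ _
    have hCV : C ⊆ V₀ := hCsub.trans (φ.mapsTo.mono_left hU).image_subset
    -- `φ⁻¹ (C)` is connected, contains `z` and lies in `U`
    have h1 : φ.symm '' C ⊆ connectedComponentIn U z := by
      refine (isPreconnected_connectedComponentIn.image _
        (φ.symm.continuousOn.mono hCV)).subset_connectedComponentIn ?_ ?_
      · exact ⟨φ z, mem_connectedComponentIn (mem_image_of_mem _ hz), φ.symm_apply_apply (hU hz)⟩
      · rintro _ ⟨w, hw, rfl⟩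
        obtain ⟨u, hu, rfl⟩ := hCsub hw
        rwa [φ.symm_apply_apply (hU hu)]
    intro w hw
    refine ⟨φ.symm w, h1 (mem_image_of_mem _ hw), φ.apply_symm_apply (hCV hw)⟩

end ConformalEquiv

/-! ### The unexplored part of `D` and its components -/

namespace MarkedDomain

variable {D : DobrushinDomain} {φ : ConformalEquiv upperHalfPlaneSet D.carrier}

/-- **The unexplored part of `D` is the image of the unexplored part of `ℍ`**: for a half-plane
set `S ⊆ ℍ̄`, `D ∖ Φ (S) = φ (ℍ ∖ S)`, where `Φ` is the boundary extension of `φ : ℍ → D`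
(`Φ = φ` is injective on `ℍ`, and real points of `S` go to `∂D`, which misses the open set `D`;
Carathéodory, Pommerenke (1992), Thm. 2.6). [folklore] -/
theorem carrier_diff_image_boundaryExtension {S : Set ℂ} (hS : S ⊆ closure upperHalfPlaneSet) :
    D.carrier \ φ.boundaryExtension '' S = φ '' (upperHalfPlaneSet \ S) := by
  ext w
  constructor
  · rintro ⟨hw, hwS⟩
    have hw' : φ.symm w ∈ upperHalfPlaneSet := φ.symm_mapsTo hw
    refine ⟨φ.symm w, ⟨hw', fun h ↦ hwS ?_⟩, φ.apply_symm_apply hw⟩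
    exact (mem_image_boundaryExtension_iff JordanDomain.exists_continuousOn_extension_holds
      hS hw).2 h
  · rintro ⟨z, ⟨hz, hzS⟩, rfl⟩
    refine ⟨φ.mapsTo hz, fun h ↦ hzS ?_⟩
    have := (mem_image_boundaryExtension_iff JordanDomain.exists_continuousOn_extension_holds
      hS (φ.mapsTo hz)).1 h
    rwa [φ.symm_apply_apply hz] at this

namespace IsChordalUniformizing

/-- **Images of bounded pieces of `ℍ` stay away from `b`.** For a chordal uniformizing map `φ`
of `(D; a, b)` and a bounded `T ⊆ ℍ`, `b ∉ closure (φ (T))`: the boundary extension `Φ` is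
continuous on `ℍ̄` (Carathéodory), so `closure (φ (T)) ⊆ Φ (closure T)`, and `Φ` takes the value
`b` (its value at `∞`) at no finite point of `ℍ̄` (`boundaryExtension_ne_pt_one`). Pommerenke
(1992), Thm. 2.6. [cite: PommerenkeBBCM1992, Thm. 2.6] -/
theorem pt_one_notMem_closure_image (hφ : D.IsChordalUniformizing φ) {T : Set ℂ}
    (hT : T ⊆ upperHalfPlaneSet) (hTb : IsBounded T) : D.pt 1 ∉ closure (φ '' T) := by
  have hcl : closure T ⊆ closure upperHalfPlaneSet := closure_mono hT
  have hcont : ContinuousOn φ.boundaryExtension (closure T) :=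
    (JordanDomain.continuousOn_boundaryExtension_holds D.toJordanDomain φ).mono hcl
  have hK : IsCompact (φ.boundaryExtension '' closure T) :=
    hTb.isCompact_closure.image_of_continuousOn hcont
  have hsub : closure (φ '' T) ⊆ φ.boundaryExtension '' closure T := by
    refine closure_minimal ?_ hK.isClosed
    rintro _ ⟨z, hz, rfl⟩
    exact ⟨z, subset_closure hz, φ.boundaryExtension_eq (hT hz)⟩
  intro hb
  obtain ⟨y, hy, hyb⟩ := hsub hb
  exact boundaryExtension_ne_pt_one JordanDomain.exists_continuousOn_extension_holds hφ
    (mem_closure_upperHalfPlaneSet_iff.1 (hcl hy)) hyb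

/-- **The image of the unbounded component accumulates at `b`.** For a chordal uniformizing
map `φ` of `(D; a, b)` and a bounded half-plane set `S`, `b ∈ closure (φ (V_∞))` for the
unbounded component `V_∞` of `ℍ ∖ S`: `V_∞` contains all far points of `ℍ`, and `Φ z → b` as
`z → ∞` in `ℍ̄` (`tendsto_boundaryExtension_cocompact`). Pommerenke (1992), Thm. 2.6; Werner
(2007), §3.2. [cite: PommerenkeBBCM1992, Thm. 2.6] -/
theorem pt_one_mem_closure_image_unboundedComponent (hφ : D.IsChordalUniformizing φ)
    {S : Set ℂ} {R : ℝ} (hS : S ⊆ closedBall 0 R) :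
    D.pt 1 ∈ closure (φ '' Loewner.unboundedComponent (upperHalfPlaneSet \ S)) := by
  rw [mem_closure_iff_nhds]
  intro N hN
  have h : ∀ᶠ z in cocompact ℂ ⊓ 𝓟 {z : ℂ | 0 ≤ z.im}, φ.boundaryExtension z ∈ N :=
    (tendsto_boundaryExtension_cocompact hφ).eventually_mem hN
  obtain ⟨t, ht, hts⟩ := Filter.mem_cocompact.1 (eventually_inf_principal.1 h)
  obtain ⟨R', hR'⟩ := ht.isBounded.subset_closedBall 0
  -- a far point `p = (|max R R'| + 1) i` of `ℍ`: in `V_∞`, outside `t`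
  obtain ⟨hp, hpR⟩ := farPoint_mem (max R R')
  have hp0 : 0 < (((|max R R'| + 1 : ℝ) : ℂ) * Complex.I).im := hp
  have hpV : ((|max R R'| + 1 : ℝ) : ℂ) * Complex.I ∈
      Loewner.unboundedComponent (upperHalfPlaneSet \ S) :=
    mem_unboundedComponent_of_lt_norm hS hp ((le_max_left _ _).trans_lt hpR)
  have hpt : ((|max R R'| + 1 : ℝ) : ℂ) * Complex.I ∉ t := fun h ↦ by
    have := mem_closedBall_zero_iff.1 (hR' h)
    linarith [le_max_right R R']
  have hpN : φ.boundaryExtension (((|max R R'| + 1 : ℝ) : ℂ) * Complex.I) ∈ N := by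
    have := hts hpt
    simp only [mem_setOf_eq] at this
    exact this hp0.le
  exact ⟨_, hpN, _, hpV, (φ.boundaryExtension_eq hp).symm⟩

end IsChordalUniformizing

end MarkedDomain

/-! ### The remaining domain -/

/-- **The remaining domain of an explored chordal curve is the conformal image of `ℍ ∖ K_r`.**
Let `φ` be a chordal uniformizing map of the Dobrushin domain `(D; a, b)` with boundary
extension `Φ`, let the Loewner chain of `W` be generated by the half-plane curve `γ`, and let
`past` be (the class of) any curve with trace `Φ (γ[0, r])`. Then the remaining domain of `D`
after exploring `past` — the union of the components of `D ∖ past` with `b` in their closure —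
equals `Φ (ℍ ∖ K_r)`, the image of the unbounded component of `ℍ ∖ γ[0, r]`. (Werner (2007),
§3.2 (2): `D_t` is the component of `D ∖ γ[0, t]` at the target; here: components of
`ℍ ∖ γ[0, r]` and of `D ∖ Φ (γ[0, r])` correspond under the homeomorphism `φ : ℍ → D`, the
unbounded one is mapped to a set accumulating at `b = Φ (∞)`, the bounded ones are not, by
Carathéodory's theorem.) [cite: Werner2007, §3.2] -/
theorem remainingDomain_eq_image_of_range_eq {D : DobrushinDomain}
    {φ : ConformalEquiv upperHalfPlaneSet D.carrier} (hφ : D.IsChordalUniformizing φ)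
    {W : ℝ≥0 → ℝ} {γ : ℝ≥0 → ℂ} (hW : Continuous W) (hγ : Loewner.IsGeneratedByCurve W γ)
    (r : ℝ≥0) (past : CurveClass ℂ)
    (hrange : past.range = φ.boundaryExtension '' (γ '' Set.Icc 0 r)) :
    remainingDomain D past = φ.boundaryExtension '' (upperHalfPlaneSet \ Loewner.hull W r) := by
  have _ := hW -- (the continuity of `W` is part of the registered signature; not needed here)
  obtain ⟨hγc, -, hγim, hhull⟩ := hγ
  set S : Set ℂ := γ '' Icc 0 r
  set V : Set ℂ := Loewner.unboundedComponent (upperHalfPlaneSet \ S) with hVdef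
  have hmemV : ∀ z, z ∈ V ↔ z ∈ upperHalfPlaneSet \ S ∧
      ¬ IsBounded (connectedComponentIn (upperHalfPlaneSet \ S) z) := fun z ↦ Iff.rfl
  have hScpt : IsCompact S := isCompact_Icc.image hγc
  obtain ⟨R, hSR⟩ := hScpt.isBounded.subset_closedBall 0
  have hSH : S ⊆ closure upperHalfPlaneSet := by
    rintro _ ⟨t, -, rfl⟩
    exact mem_closure_upperHalfPlaneSet_iff.2 (hγim t)
  have hVsub : V ⊆ upperHalfPlaneSet \ S := Loewner.unboundedComponent_subset _
  -- `ℍ ∖ K_r = V_∞`, and `Φ = φ` there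
  have hdiff : upperHalfPlaneSet \ Loewner.hull W r = V := by
    rw [hhull r]
    exact Set.sdiff_sdiff_cancel_left (hVsub.trans sdiff_subset)
  have himg : φ.boundaryExtension '' V = φ '' V :=
    EqOn.image_eq fun z hz ↦ φ.boundaryExtension_eq (hVsub hz).1
  -- `V_∞` is the component of each of its points
  have hVeq : ∀ z ∈ V, connectedComponentIn (upperHalfPlaneSet \ S) z = V := by
    intro z hz
    obtain ⟨hp, hpR⟩ := farPoint_mem R
    have hV' := unboundedComponent_eq_connectedComponentIn hSR hp hpR
    rw [hVdef, hV'] at hz ⊢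
    exact (connectedComponentIn_eq hz).symm
  rw [hdiff, himg]
  ext w
  rw [remainingDomain, mem_setOf_eq, hrange, MarkedDomain.carrier_diff_image_boundaryExtension hSH]
  constructor
  · rintro ⟨⟨z, hz, rfl⟩, hb⟩
    rw [← φ.image_connectedComponentIn sdiff_subset hz] at hb
    refine ⟨z, (hmemV z).2 ⟨hz, fun hbd ↦ ?_⟩, rfl⟩
    exact MarkedDomain.IsChordalUniformizing.pt_one_notMem_closure_image hφ
      ((connectedComponentIn_subset _ _).trans sdiff_subset) hbd hb
  · rintro ⟨z, hzV, rfl⟩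
    refine ⟨⟨z, hVsub hzV, rfl⟩, ?_⟩
    rw [← φ.image_connectedComponentIn sdiff_subset (hVsub hzV), hVeq z hzV]
    exact MarkedDomain.IsChordalUniformizing.pt_one_mem_closure_image_unboundedComponent hφ hSR

end Literature.Probability.RandomPlanarGeometry

end
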